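import Summits.CriticalPhenomena.PercolationContinuityZ3.Theorems.PercNearOneGluingNoHeavyLowerTailCombRowsLeFive
import HarnessLib

/-!
# The two-link DEFICIT row `W0` on every weighted graph with at most five vertices (kernel-checked, two-copy comb positive)

Support file for crux `stmt-CriticalPhenomena-4575` (`NoHeavyLowerTail`), seat `prim-l12-p1` gen 12 (`--supports stmt-CriticalPhenomena-4575`;
COMPUTATIONAL: two `checkC` evaluations use `native_decide`).  Memo `run/shared/lean/prim/prim-l12/FROM-prim-l12-p1-g12-W0-TWO-LINK-DEFICIT.md`.

Bond percolation `μ = prodBernoulli w` with arbitrary edge weights on `Fin n`, four distinct vertices `a b c y`; write `P(π)` for the probability that the open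
clusters induce the partition `π` of `{a,b,c,y}`.  van den Berg–Häggström–Kahn's two-set negative correlation gives the "two-link" row
`P(ab|cy)·P(a|b|c|y) ≤ P(ab|c|y)·P(a|b|cy)` (`Q44bExchange.twoLink_cells`).  THE NEW ROW bounds the DEFICIT of that inequality:

  `(W0)   P(ab|c|y)·P(a|b|cy) ≤ P(ab|cy)·[P(a|b|c|y) + P(ab|c|y)] + P(a|b|c|y)·[P(a|bcy) + P(acy|b)]`,

i.e. `P(ab|c|y)P(a|b|cy) − P(ab|cy)P(∅) ≤ P(ab|cy)P(ab|c|y) + P(∅)[P(a|bcy)+P(acy|b)]`.  It is a quadratic two-copy row of a new kind (not a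
nine-type/`GoodKernel` count; it cuts the exact law-level pseudo-law of dec frontier row 44 of `prim-l12-p1` gen 11 by `0.035`), sharper than the
conjectural row `B8` of gen 11 (which it implies).  Evidence for all `n`: two-copy comb positive on `K₄ … K₇` (kit j146541: `10 460 353 203` fibre intervals,
`0` negative), exhaustive multigraph fibres `≤ 6` vertices `≤ 9` edges, and an adaptive Gladkov–Zimin swap tree exists on every fibre with `≤ 7` vertices and `≤ 8` edges
(memo §3).  THIS FILE proves it for every `n ≤ 5`, every weight vector and all pairwise distinct `a b c y`, by the generic packaging `CombRows.quad_cval_le_five`: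
the five-term family `w0Terms` is relabelling-equivariant (`rfl`) and passes prim-cert-2's three-copy comb checker `checkC` at the standard quadruple of `K₄` and `K₅`
(a quadratic row with a `pTrue` third factor is three-copy comb positive iff it is two-copy comb positive).  Nothing is claimed here beyond five vertices.

Main results: `w0_cval_le_five` (term form), `w0_le_five` (the displayed inequality, cells written as intersections of the six connection events
`ab, ac, ay, bc, by, cy` and their complements).
-/

namespace Summit.CriticalPhenomena.PercolationContinuityZ3.Theorems.TwoLinkDeficit

open Finset MeasureTheory OneCutCert CovTransferCert E3GroupSepCert CombRows
open scoped BigOperators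
open Literature.Probability.Percolation Literature.Probability.LatticeModels

variable {n : ℕ}

/-! ## The six cells of the row as connectivity predicates (literal order `ab, ac, ay, bc, by, cy`) -/

/-- Cell `a|b|c|y` (all four marked vertices in different clusters). [this work] -/
def pBot (a b c y : Fin n) : CRel n → Bool := fun r => !(r a b) && !(r a c) && !(r a y) && !(r b c) && !(r b y) && !(r c y)
/-- Cell `ab|c|y`. [this work] -/
def pSab (a b c y : Fin n) : CRel n → Bool := fun r => r a b && !(r a c) && !(r a y) && !(r b c) && !(r b y) && !(r c y)
/-- Cell `a|b|cy`. [this work] -/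
def pScy (a b c y : Fin n) : CRel n → Bool := fun r => !(r a b) && !(r a c) && !(r a y) && !(r b c) && !(r b y) && r c y
/-- Cell `ab|cy`. [this work] -/
def pP11 (a b c y : Fin n) : CRel n → Bool := fun r => r a b && !(r a c) && !(r a y) && !(r b c) && !(r b y) && r c y
/-- Cell `a|bcy`. [this work] -/
def pKa (a b c y : Fin n) : CRel n → Bool := fun r => !(r a b) && !(r a c) && !(r a y) && r b c && r b y && r c y
/-- Cell `acy|b`. [this work] -/
def pKb (a b c y : Fin n) : CRel n → Bool := fun r => !(r a b) && r a c && r a y && !(r b c) && !(r b y) && r c y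

/-- The five signed terms of `W0` (right side minus left side), third factor trivial:
`P(ab|cy)P(∅) + P(ab|cy)P(ab|c|y) + P(∅)P(a|bcy) + P(∅)P(acy|b) − P(ab|c|y)P(a|b|cy)`. [this work] -/
def w0Terms (n : ℕ) (x : Quad n) : List (CTerm n) :=
  let a := x.1
  let b := x.2.1
  let c := x.2.2.1
  let y := x.2.2.2
  [((1 : ℤ), pTrue, pP11 a b c y, pBot a b c y), ((1 : ℤ), pTrue, pP11 a b c y, pSab a b c y),
    ((1 : ℤ), pTrue, pBot a b c y, pKa a b c y), ((1 : ℤ), pTrue, pBot a b c y, pKb a b c y),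
    ((-1 : ℤ), pTrue, pSab a b c y, pScy a b c y)]

/-- The family commutes with vertex relabellings. [this work] -/
theorem w0Terms_equivariant : QuadEquivariant w0Terms := by
  intro n τ x
  obtain ⟨a, b, c, y⟩ := x
  rfl

/-- `K₄` check (base `2^23`). [this work] -/
theorem checkW0_4 : checkC 4 23 (w0Terms 4 (quad₀ 4 le_rfl)) = true := by native_decide

/-- `K₅` check (base `2^35`). [this work] -/
theorem checkW0_5 : checkC 5 35 (w0Terms 5 (quad₀ 5 (by norm_num))) = true := by native_decide

/-- **`W0` (term form) on every weighted graph with at most five vertices.** [this work] -/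
theorem w0_cval_le_five : ∀ n ≤ 5, ∀ (w : Sym2 (Fin n) → unitInterval) (a b c y : Fin n),
    a ≠ b → a ≠ c → a ≠ y → b ≠ c → b ≠ y → c ≠ y → 0 ≤ cval w (w0Terms n (a, b, c, y)) :=
  quad_cval_le_five w0Terms_equivariant checkW0_4 checkW0_5

/-! ## The cells as intersections of connection events -/

section cells
variable (a b c y : Fin n)

/-- Cell `a|b|c|y` in `openConn` notation. [this work] -/
theorem connEvent_pBot : connEvent (pBot a b c y) =
    (openConn a b)ᶜ ∩ (openConn a c)ᶜ ∩ (openConn a y)ᶜ ∩ (openConn b c)ᶜ ∩ (openConn b y)ᶜ ∩ (openConn c y)ᶜ := by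
  ext ω
  simp only [connEvent, pBot, Set.mem_setOf_eq, Set.mem_inter_iff, Set.mem_compl_iff, Bool.and_eq_true, Bool.not_eq_true',
    decide_eq_false_iff_not]
/-- Cell `ab|c|y` in `openConn` notation. [this work] -/
theorem connEvent_pSab : connEvent (pSab a b c y) =
    openConn a b ∩ (openConn a c)ᶜ ∩ (openConn a y)ᶜ ∩ (openConn b c)ᶜ ∩ (openConn b y)ᶜ ∩ (openConn c y)ᶜ := by
  ext ω
  simp only [connEvent, pSab, Set.mem_setOf_eq, Set.mem_inter_iff, Set.mem_compl_iff, Bool.and_eq_true, Bool.not_eq_true',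
    decide_eq_true_eq, decide_eq_false_iff_not]
/-- Cell `a|b|cy` in `openConn` notation. [this work] -/
theorem connEvent_pScy : connEvent (pScy a b c y) =
    (openConn a b)ᶜ ∩ (openConn a c)ᶜ ∩ (openConn a y)ᶜ ∩ (openConn b c)ᶜ ∩ (openConn b y)ᶜ ∩ openConn c y := by
  ext ω
  simp only [connEvent, pScy, Set.mem_setOf_eq, Set.mem_inter_iff, Set.mem_compl_iff, Bool.and_eq_true, Bool.not_eq_true',
    decide_eq_true_eq, decide_eq_false_iff_not]
/-- Cell `ab|cy` in `openConn` notation. [this work] -/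
theorem connEvent_pP11 : connEvent (pP11 a b c y) =
    openConn a b ∩ (openConn a c)ᶜ ∩ (openConn a y)ᶜ ∩ (openConn b c)ᶜ ∩ (openConn b y)ᶜ ∩ openConn c y := by
  ext ω
  simp only [connEvent, pP11, Set.mem_setOf_eq, Set.mem_inter_iff, Set.mem_compl_iff, Bool.and_eq_true, Bool.not_eq_true',
    decide_eq_true_eq, decide_eq_false_iff_not]
/-- Cell `a|bcy` in `openConn` notation. [this work] -/
theorem connEvent_pKa : connEvent (pKa a b c y) =
    (openConn a b)ᶜ ∩ (openConn a c)ᶜ ∩ (openConn a y)ᶜ ∩ openConn b c ∩ openConn b y ∩ openConn c y := by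
  ext ω
  simp only [connEvent, pKa, Set.mem_setOf_eq, Set.mem_inter_iff, Set.mem_compl_iff, Bool.and_eq_true, Bool.not_eq_true',
    decide_eq_true_eq, decide_eq_false_iff_not]
/-- Cell `acy|b` in `openConn` notation. [this work] -/
theorem connEvent_pKb : connEvent (pKb a b c y) =
    (openConn a b)ᶜ ∩ openConn a c ∩ openConn a y ∩ (openConn b c)ᶜ ∩ (openConn b y)ᶜ ∩ openConn c y := by
  ext ω
  simp only [connEvent, pKb, Set.mem_setOf_eq, Set.mem_inter_iff, Set.mem_compl_iff, Bool.and_eq_true, Bool.not_eq_true',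
    decide_eq_true_eq, decide_eq_false_iff_not]

end cells

/-- **The two-link deficit row `W0` on every weighted graph with at most five vertices**: for `n ≤ 5`, every `w` and all pairwise distinct
`a b c y : Fin n`,
`P(ab|c|y)·P(a|b|cy) ≤ P(ab|cy)·P(a|b|c|y) + P(ab|cy)·P(ab|c|y) + P(a|b|c|y)·P(a|bcy) + P(a|b|c|y)·P(acy|b)`
(cells as intersections of the six connection events `ab, ac, ay, bc, by, cy` and their complements). [this work] -/
theorem w0_le_five (hn : n ≤ 5) (w : Sym2 (Fin n) → unitInterval) (a b c y : Fin n) (hab : a ≠ b) (hac : a ≠ c) (hay : a ≠ y)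
    (hbc : b ≠ c) (hby : b ≠ y) (hcy : c ≠ y) :
    (prodBernoulli w).real (openConn a b ∩ (openConn a c)ᶜ ∩ (openConn a y)ᶜ ∩ (openConn b c)ᶜ ∩ (openConn b y)ᶜ ∩ (openConn c y)ᶜ) *
        (prodBernoulli w).real ((openConn a b)ᶜ ∩ (openConn a c)ᶜ ∩ (openConn a y)ᶜ ∩ (openConn b c)ᶜ ∩ (openConn b y)ᶜ ∩ openConn c y) ≤
      (prodBernoulli w).real (openConn a b ∩ (openConn a c)ᶜ ∩ (openConn a y)ᶜ ∩ (openConn b c)ᶜ ∩ (openConn b y)ᶜ ∩ openConn c y) *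
          (prodBernoulli w).real ((openConn a b)ᶜ ∩ (openConn a c)ᶜ ∩ (openConn a y)ᶜ ∩ (openConn b c)ᶜ ∩ (openConn b y)ᶜ ∩ (openConn c y)ᶜ) +
        (prodBernoulli w).real (openConn a b ∩ (openConn a c)ᶜ ∩ (openConn a y)ᶜ ∩ (openConn b c)ᶜ ∩ (openConn b y)ᶜ ∩ openConn c y) *
          (prodBernoulli w).real (openConn a b ∩ (openConn a c)ᶜ ∩ (openConn a y)ᶜ ∩ (openConn b c)ᶜ ∩ (openConn b y)ᶜ ∩ (openConn c y)ᶜ) +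
        (prodBernoulli w).real ((openConn a b)ᶜ ∩ (openConn a c)ᶜ ∩ (openConn a y)ᶜ ∩ (openConn b c)ᶜ ∩ (openConn b y)ᶜ ∩ (openConn c y)ᶜ) *
          (prodBernoulli w).real ((openConn a b)ᶜ ∩ (openConn a c)ᶜ ∩ (openConn a y)ᶜ ∩ openConn b c ∩ openConn b y ∩ openConn c y) +
        (prodBernoulli w).real ((openConn a b)ᶜ ∩ (openConn a c)ᶜ ∩ (openConn a y)ᶜ ∩ (openConn b c)ᶜ ∩ (openConn b y)ᶜ ∩ (openConn c y)ᶜ) *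
          (prodBernoulli w).real ((openConn a b)ᶜ ∩ openConn a c ∩ openConn a y ∩ (openConn b c)ᶜ ∩ (openConn b y)ᶜ ∩ openConn c y) := by
  have h := w0_cval_le_five n hn w a b c y hab hac hay hbc hby hcy
  unfold w0Terms cval at h
  simp only [List.map_cons, List.map_nil, List.sum_cons, List.sum_nil, pr_pTrue] at h
  unfold pr at h
  rw [connEvent_pBot, connEvent_pSab, connEvent_pScy, connEvent_pP11, connEvent_pKa, connEvent_pKb] at h
  push_cast at h
  linarith

end Summit.CriticalPhenomena.PercolationContinuityZ3.Theorems.TwoLinkDeficit
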